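import Mathlib
import HarnessLib
import Summits.HubbardSuperconductivity.HubbardSuperconductivity.Theorems.KLProgrammeKLRegimeVolumeLimitTwoPointHamiltonianBound
import Summits.HubbardSuperconductivity.HubbardSuperconductivity.Theorems.KLProgrammeKLRegimeVolumeLimitTwoPointLabelLimit

/-!
# The per-label `M → ∞` limit of the bare VL carrier IS the re-amputated Hamiltonian self-energy (named, under (H1))
# (seat hubbard-kl-k3c5-p2, g3, «analytic-continuation-free assembly via FinalTwoLegVolLimit»)

Route `KLProgramme`, gen-4 child 5 (stmt-HubbardSuperconductivity-19858).  `…VolumeLimitTwoPointHamiltonianBound` proved the BOUND of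
`stub_vl_bound_of_hamiltonianBound` from (H1) with the identification buried inside the proof.  For the Cauchy stub `stub_vl_twoVolumeRate`
(k3c4-p1's doors `twoVolumeRate_of_matsubaraLimit` / `stub_vl_twoVolumeRate_of_bareSplit`: `hcut` = per-volume Matsubara limit of the carrier
towards ANY cutoff-free proxy `Σ∞_L(n,p)`, `hvol` = two-volume rate OF THE PROXY) the lane needs the proxy NAMED.  Under (H1) the natural proxy is
purely Hamiltonian (`M = ∞`, finite `L`): the re-amputated Matsubara Green function of `…ThermalGreenHubbardTorus*`,

  `Σ_H(L; n, p) := (1/D_p − 𝒢_{H'}(k₀, −p)) · D_p²`,  `D_p = −ik₀ + ε(p) − μ`,  `k₀ = (2n+1)π/β`,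
  `𝒢_{H'}(k₀, q) = ∫₀^β e^{ik₀τ} ⟨c_{q↑}(τ) c†_{q↑}⟩_{H'} dτ`,  `H' = hubbardTorusWith 2 L 1 U (μ + U/2)`:

* **`twoPointTransform_limUnder_div_eq_neg_matsubaraGreen`** — under (H1) at `L`:
  `(∫₀^β Σ_x e^{−ik₀s} conj χ_p(x) · lim_M W_M(x,0,s) ds) / D∞ = −𝒢_{H'}(k₀, −p)` (the `Iinf n p / D∞` of k3c5-p3's chain);
* **`klSelfEnergy_bare_label_limit_eq_reamputated`** — under (H1) at `L ≥ 3`: for every Matsubara integer `n`, momentum `p`, `ε > 0`,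
  `∃ M₁, ∀ M ≥ M₁, ∀ ω, matsubaraInt M ω = n → ‖klSelfEnergy L M β U μ 0 klE0 (nScales β + 1) (ω, p) 0 − Σ_H(L; n, p)‖ ≤ ε`
  (k3c5-p3's `klSelfEnergy_bare_label_limit` with `Pinf = lim_M W_M`, `L¹` convergence from k3c4-p2's word machine, + the first bullet);
* `norm_reamputatedProxy_le` — `‖Σ_H(L; n, p)‖ ≤ (1 + |U/2|β/π)(|U/2| + (1 + |U/2|β/π)|U|(2 + β|U|))` for all `L ≥ 3`, `n`, `p` (p474312).

So, given (H1), `hcut` holds per label with the HAMILTONIAN proxy, every proxy of the lane agrees with `Σ_H` (uniqueness of limits), and `hvol`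
becomes a statement about the finite-volume Gibbs state of `hubbardTorusWith` alone.  Everything is proved; no definition.
-/

noncomputable section

namespace Summit.HubbardSuperconductivity.HubbardSuperconductivity.Theorems.TwoPointAssembly

set_option linter.dupNamespace false -- summit = problem name (single-conjunct summit), D-0017

open Finset Filter Topology MeasureTheory intervalIntegral Complex Literature.MathematicalPhysics.QuantumLattice Literature.Probability.LatticeModels
  GrassmannAlgebra
open Summit.HubbardSuperconductivity.HubbardSuperconductivity.Theorems.ThermalGreen
open Summit.HubbardSuperconductivity.HubbardSuperconductivity.Theorems.MatsubaraAllU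
open Summit.HubbardSuperconductivity.HubbardSuperconductivity.Theorems.KLRegimeSplit
open Summit.HubbardSuperconductivity.HubbardSuperconductivity.Theorems.KLProgrammeLegKernels
open scoped ComplexConjugate ComplexOrder Matrix.Norms.L2Operator

variable {L : ℕ} [NeZero L]

/-- **THE TRANSFORM OF THE LIMIT IS MINUS THE HAMILTONIAN GREEN FUNCTION** (under (H1) at one volume `L`, every `U`, `β > 0`): with
`k₀ = (2n+1)π/β`, `(∫₀^β Σ_x e^{−ik₀s} conj χ_p(x)·lim_M ∫dμ_{C_M}ψ⁺_{(x,s)↑}ψ⁻_{(0,0)↑}e^{−V} ds) / D∞ = −∫₀^β e^{ik₀τ}⟨c_{−p↑}(τ)c†_{−p↑}⟩_{H'} dτ`. -/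
theorem twoPointTransform_limUnder_div_eq_neg_matsubaraGreen {β : ℝ} (hβ : 0 < β) (U μ : ℝ)
    (hH1 : ∀ (x y : TorusSite 2 L), ∀ s ∈ Set.Ioo (0 : ℝ) β,
      Tendsto (fun M : ℕ => gaussExpect ℂ (hubbardCovariance L M β μ 0)
          (positionField L M β 0 0 x s * positionField L M β 1 0 y 0 * grassmannExp (-(hubbardInteraction L M β U)))) atTop
        (𝓝 ((Real.exp (-(β * U / 4 * (L : ℝ) ^ 2)) : ℂ) *
          (Matrix.gibbsWeight (β - s) (hubbardTorusWith 2 L 1 U (μ + U / 2)) * creation (orb (FermionTorus.ofTorusSite x) 0) *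
            (Matrix.gibbsWeight s (hubbardTorusWith 2 L 1 U (μ + U / 2)) * annihilation (orb (FermionTorus.ofTorusSite y) 0))).trace /
          Matrix.partitionFn β (hubbardTorusWith 2 L 1 0 μ))))
    (n : ℤ) (p : TorusSite 2 L) :
    (∫ s in (0 : ℝ)..β, ∑ x : TorusSite 2 L,
        Complex.exp (-(((Real.pi * (2 * (n : ℝ) + 1) / β * s : ℝ) : ℂ) * Complex.I)) * conj (torusChar p x) *
          limUnder atTop (fun M : ℕ => gaussExpect ℂ (hubbardCovariance L M β μ 0)
            (positionField L M β 0 0 x s * positionField L M β 1 0 0 0 * grassmannExp (-(hubbardInteraction L M β U))))) /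
        (((Real.exp (-(β * U / 4 * (L : ℝ) ^ 2)) : ℝ) : ℂ) * Matrix.partitionFn β (hubbardTorusWith 2 L 1 U (μ + U / 2)) /
          Matrix.partitionFn β (hubbardTorusWith 2 L 1 0 μ)) =
      -∫ τ in (0 : ℝ)..β, cexp (I * ((Real.pi * (2 * (n : ℝ) + 1) / β : ℝ) : ℂ) * τ) *
        Matrix.gibbsState β (hubbardTorusWith 2 L 1 U (μ + U / 2))
          (Matrix.imagTimeEvolve (hubbardTorusWith 2 L 1 U (μ + U / 2)) (τ : ℂ) (momentumAnnihilation (-p) 0) *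
            momentumCreation (-p) 0) := by
  haveI : Nonempty (Finset (Orb (FermionTorus 2 L))) := ⟨∅⟩
  -- names
  set H' := hubbardTorusWith 2 L 1 U (μ + U / 2) with hH'
  set Ec : ℂ := ((Real.exp (-(β * U / 4 * (L : ℝ) ^ 2)) : ℝ) : ℂ) with hEc
  set Z₀ : ℂ := Matrix.partitionFn β (hubbardTorusWith 2 L 1 0 μ) with hZ₀
  set Z' : ℂ := Matrix.partitionFn β H' with hZ'
  set k₀ : ℝ := Real.pi * (2 * (n : ℝ) + 1) / β with hk₀
  have hk₀f : k₀ = fermiMatsubara β n := rfl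
  have hk : cexp (I * k₀ * β) = -1 := by rw [hk₀f]; exact cexp_fermiMatsubara_mul_beta hβ.ne' n
  have hZ₀ne : Z₀ ≠ 0 := (Matrix.partitionFn_pos β (isHermitian_hamiltonianWith (fermionTorusGraph 2 L) 1 0 μ)).ne'
  have hZ'ne : Z' ≠ 0 := (Matrix.partitionFn_pos β (isHermitian_hamiltonianWith (fermionTorusGraph 2 L) 1 U (μ + U / 2))).ne'
  have hEne : Ec ≠ 0 := by rw [hEc]; exact_mod_cast (Real.exp_pos _).ne'
  have hDne : Ec * Z' / Z₀ ≠ 0 := div_ne_zero (mul_ne_zero hEne hZ'ne) hZ₀ne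
  -- the (H1) values and the words
  obtain ⟨val, hval⟩ : ∃ val : TorusSite 2 L → TorusSite 2 L → ℝ → ℂ, ∀ x y s, val x y s =
      Ec * (Matrix.gibbsWeight (β - s) H' * creation (orb (FermionTorus.ofTorusSite x) 0) *
        (Matrix.gibbsWeight s H' * annihilation (orb (FermionTorus.ofTorusSite y) 0))).trace / Z₀ := ⟨_, fun _ _ _ => rfl⟩
  obtain ⟨W, hW⟩ : ∃ W : ℕ → TorusSite 2 L → TorusSite 2 L → ℝ → ℂ, ∀ M x y s, W M x y s = gaussExpect ℂ (hubbardCovariance L M β μ 0)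
      (positionField L M β 0 0 x s * positionField L M β 1 0 y 0 * grassmannExp (-(hubbardInteraction L M β U))) :=
    ⟨_, fun _ _ _ _ => rfl⟩
  have hH1' : ∀ x y, ∀ s ∈ Set.Ioo (0 : ℝ) β, Tendsto (fun M : ℕ => W M x y s) atTop (𝓝 (val x y s)) := by
    intro x y s hs; simp only [hW, hval]; exact hH1 x y s hs
  -- `limUnder` = the (H1) value, and translation invariance of the values
  have hlim : ∀ x, ∀ s ∈ Set.Ioo (0 : ℝ) β, limUnder atTop (fun M : ℕ => W M x 0 s) = val x 0 s := fun x s hs => (hH1' x 0 s hs).limUnder_eq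
  have htrans : ∀ x y, ∀ s ∈ Set.Ioo (0 : ℝ) β, val x y s = val (x - y) 0 s := by
    intro x y s hs
    refine tendsto_nhds_unique (hH1' x y s hs) ?_
    have h := hH1' (x - y) 0 s hs
    have heq : (fun M : ℕ => W M x y s) = fun M : ℕ => W M (x - y) 0 s := funext fun M => by
      rw [hW, hW]; exact twoPointWord_translate β U μ 0 x y s
    rw [heq]; exact h
  -- single sum = double sum on the values
  have hsd : ∀ s ∈ Set.Ioo (0 : ℝ) β, ∑ x : TorusSite 2 L, conj (torusChar p x) * val x 0 s =
      ((L : ℂ) ^ 2)⁻¹ * ∑ x : TorusSite 2 L, ∑ y : TorusSite 2 L, conj (torusChar p x) * torusChar p y * val x y s := by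
    intro s hs
    have hL2 : ((L : ℂ) ^ 2) ≠ 0 := pow_ne_zero 2 (by exact_mod_cast NeZero.ne L)
    have hinner : ∀ y : TorusSite 2 L, ∑ x : TorusSite 2 L, conj (torusChar p x) * torusChar p y * val x y s =
        ∑ z : TorusSite 2 L, conj (torusChar p z) * val z 0 s := by
      intro y
      have hre : ∑ x : TorusSite 2 L, conj (torusChar p x) * torusChar p y * val x y s =
          ∑ z : TorusSite 2 L, conj (torusChar p (z + y)) * torusChar p y * val (z + y) y s :=
        (Fintype.sum_equiv (Equiv.addRight y) _ _ fun z => rfl).symm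
      rw [hre]
      refine Finset.sum_congr rfl fun z _ => ?_
      rw [htrans _ _ s hs, add_sub_cancel_right, torusChar_add_right, map_mul]
      have h1 : conj (torusChar p y) * torusChar p y = 1 := by rw [mul_comm, torusChar_mul_conj]
      calc conj (torusChar p z) * conj (torusChar p y) * torusChar p y * val z 0 s
          = conj (torusChar p z) * (conj (torusChar p y) * torusChar p y) * val z 0 s := by ring
        _ = conj (torusChar p z) * val z 0 s := by rw [h1, mul_one]
    rw [Finset.sum_comm]
    simp_rw [hinner]
    rw [Finset.sum_const, Finset.card_univ, nsmul_eq_mul]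
    have hcard : ((Fintype.card (TorusSite 2 L) : ℕ) : ℂ) = (L : ℂ) ^ 2 := by
      rw [Fintype.card_pi, prod_const, ZMod.card, card_univ, Fintype.card_fin]; push_cast; ring
    rw [hcard, ← mul_assoc, inv_mul_cancel₀ hL2, one_mul]
  -- value / D∞ = the reflected two-time Gibbs correlation
  have hvalD : ∀ x y (s : ℝ), val x y s / (Ec * Z' / Z₀) =
      Matrix.gibbsState β H' (Matrix.imagTimeEvolve H' ((β - s : ℝ) : ℂ) (annihilation (orb (FermionTorus.ofTorusSite y) 0)) *
        creation (orb (FermionTorus.ofTorusSite x) 0)) := by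
    intro x y s
    rw [gibbsState_imagTimeEvolve_mul_kms]
    have : ((β : ℂ) - ((β - s : ℝ) : ℂ)) = ((s : ℝ) : ℂ) := by push_cast; ring
    rw [this, ← trace_gibbsWeight_twoTime_div, ← hZ', hval]
    field_simp
  -- the integral of hB, rewritten through (H1)
  have hae : ∀ᵐ s ∂(volume : Measure ℝ), s ∈ Set.uIoc (0 : ℝ) β → s ∈ Set.Ioo (0 : ℝ) β := by
    have h : ∀ᵐ u ∂(volume : Measure ℝ), u ∉ ({β} : Set ℝ) := measure_eq_zero_iff_ae_notMem.1 Real.volume_singleton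
    filter_upwards [h] with s hs hsI
    rw [Set.uIoc_of_le hβ.le] at hsI
    exact ⟨hsI.1, lt_of_le_of_ne hsI.2 fun h => hs (Set.mem_singleton_iff.2 h)⟩
  have hI : (∫ s in (0 : ℝ)..β, ∑ x : TorusSite 2 L,
        Complex.exp (-(((k₀ * s : ℝ) : ℂ) * Complex.I)) * conj (torusChar p x) * limUnder atTop (fun M : ℕ => W M x 0 s)) /
        (Ec * Z' / Z₀) =
      -∫ τ in (0 : ℝ)..β, cexp (I * k₀ * τ) * Matrix.gibbsState β H'
        (Matrix.imagTimeEvolve H' (τ : ℂ) (momentumAnnihilation (-p) 0) * momentumCreation (-p) 0) := by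
    rw [hH', matsubaraGreen_eq_neg_integral_siteSum U (μ + U / 2) β (-p) hk, neg_neg, ← hH', ← intervalIntegral.integral_div]
    refine intervalIntegral.integral_congr_ae ?_
    filter_upwards [hae] with s hsI hsu
    have hs := hsI hsu
    -- left: (H1) values, single → double sum, divide
    have hleft : (∑ x : TorusSite 2 L, Complex.exp (-(((k₀ * s : ℝ) : ℂ) * Complex.I)) * conj (torusChar p x) *
        limUnder atTop (fun M : ℕ => W M x 0 s)) / (Ec * Z' / Z₀) =
        Complex.exp (-(((k₀ * s : ℝ) : ℂ) * Complex.I)) * (((L : ℂ) ^ 2)⁻¹ *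
          ∑ x : TorusSite 2 L, ∑ y : TorusSite 2 L, conj (torusChar p x) * torusChar p y * (val x y s / (Ec * Z' / Z₀))) := by
      have h1 : ∑ x : TorusSite 2 L, Complex.exp (-(((k₀ * s : ℝ) : ℂ) * Complex.I)) * conj (torusChar p x) *
          limUnder atTop (fun M : ℕ => W M x 0 s) =
          Complex.exp (-(((k₀ * s : ℝ) : ℂ) * Complex.I)) * ∑ x : TorusSite 2 L, conj (torusChar p x) * val x 0 s := by
        rw [Finset.mul_sum]
        refine Finset.sum_congr rfl fun x _ => ?_
        rw [hlim x s hs, mul_assoc]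
      rw [h1, hsd s hs, mul_div_assoc, mul_div_assoc, Finset.sum_div]
      congr 2
      refine Finset.sum_congr rfl fun x _ => ?_
      rw [Finset.sum_div]
      refine Finset.sum_congr rfl fun y _ => ?_
      rw [mul_div_assoc]
    rw [hleft, Finset.mul_sum]
    simp_rw [Finset.mul_sum]
    rw [Finset.sum_comm]
    refine Finset.sum_congr rfl fun a _ => Finset.sum_congr rfl fun b _ => ?_
    rw [hvalD, torusChar_neg_left', torusChar_neg_left', Complex.conj_conj]
    have hw : torusFourierWeight 2 L * torusFourierWeight 2 L = ((L : ℂ) ^ 2)⁻¹ := torusFourierWeight_mul_self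
    rw [← hw]
    ring
  -- rewrite the integrand through `W` and conclude
  have hWlim : (fun s : ℝ => ∑ x : TorusSite 2 L, Complex.exp (-(((k₀ * s : ℝ) : ℂ) * Complex.I)) * conj (torusChar p x) *
      limUnder atTop (fun M : ℕ => gaussExpect ℂ (hubbardCovariance L M β μ 0)
        (positionField L M β 0 0 x s * positionField L M β 1 0 0 0 * grassmannExp (-(hubbardInteraction L M β U))))) =
      fun s : ℝ => ∑ x : TorusSite 2 L, Complex.exp (-(((k₀ * s : ℝ) : ℂ) * Complex.I)) * conj (torusChar p x) *
        limUnder atTop (fun M : ℕ => W M x 0 s) := by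
    funext s
    refine Finset.sum_congr rfl fun x _ => ?_
    congr 2
    funext M
    rw [hW]
  rw [hWlim, hI]

/-- **The Hamiltonian proxy is bounded uniformly in `L ≥ 3`, `n`, `p`** (k3c5-p2 g2 frame form, chemical potential `μ + U/2`, shift `U/2`):
`‖(1/D_p − 𝒢_{H'}(k₀,−p))·D_p²‖ ≤ (1 + |U/2|β/π)(|U/2| + (1 + |U/2|β/π)|U|(2 + β|U|))`, `D_p = −ik₀ + ε(p) − μ`. -/
theorem norm_reamputatedProxy_le (hL : 3 ≤ L) {β : ℝ} (hβ : 0 < β) (U μ : ℝ) (n : ℤ) (p : TorusSite 2 L) :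
    ‖(1 / (-Complex.I * ((Real.pi * (2 * (n : ℝ) + 1) / β : ℝ) : ℂ) + (nambuXiCT L μ 0 p : ℂ)) -
          ∫ τ in (0 : ℝ)..β, cexp (I * ((Real.pi * (2 * (n : ℝ) + 1) / β : ℝ) : ℂ) * τ) *
            Matrix.gibbsState β (hubbardTorusWith 2 L 1 U (μ + U / 2))
              (Matrix.imagTimeEvolve (hubbardTorusWith 2 L 1 U (μ + U / 2)) (τ : ℂ) (momentumAnnihilation (-p) 0) *
                momentumCreation (-p) 0)) *
        (-Complex.I * ((Real.pi * (2 * (n : ℝ) + 1) / β : ℝ) : ℂ) + (nambuXiCT L μ 0 p : ℂ)) ^ 2‖ ≤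
      (1 + |U / 2| * β / Real.pi) * (|U / 2| + (1 + |U / 2| * β / Real.pi) * (|U| * (2 + β * |U|))) := by
  have hDp : (-Complex.I * ((Real.pi * (2 * (n : ℝ) + 1) / β : ℝ) : ℂ) + ((nambuXiCT L μ 0 p : ℝ) : ℂ)) =
      -I * ((fermiMatsubara β n : ℝ) : ℂ) + ((torusBand L (-p) - (μ + U / 2) : ℝ) : ℂ) + ((U / 2 : ℝ) : ℂ) := by
    rw [nambuXiCT_zero_frame, nambuXi, torusBand_neg, fermiMatsubara]
    push_cast
    ring
  rw [hDp]
  exact norm_reamputated_matsubaraGreen_frame_le_fermi hL U (μ + U / 2) (U / 2) hβ (-p) n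

/-- **THE PER-LABEL LIMIT OF THE BARE CARRIER IS THE RE-AMPUTATED HAMILTONIAN SELF-ENERGY** (under (H1) at `L ≥ 3`; every `U`, `β > 0`): for
every Matsubara integer `n`, torus momentum `p` and `ε > 0` there is `M₁` with
`‖klSelfEnergy L M β U μ 0 klE0 (nScales β + 1) (ω, p) 0 − (1/D_p − 𝒢_{H'}(k₀, −p))·D_p²‖ ≤ ε` for all `M ≥ M₁` and every kept index `ω` of
integer `n` (`D_p = −ik₀ + ε(p) − μ`, `k₀ = (2n+1)π/β`). -/
theorem klSelfEnergy_bare_label_limit_eq_reamputated (hL : 3 ≤ L) {β : ℝ} (hβ : 0 < β) (U μ : ℝ)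
    (hH1 : ∀ (x y : TorusSite 2 L), ∀ s ∈ Set.Ioo (0 : ℝ) β,
      Tendsto (fun M : ℕ => gaussExpect ℂ (hubbardCovariance L M β μ 0)
          (positionField L M β 0 0 x s * positionField L M β 1 0 y 0 * grassmannExp (-(hubbardInteraction L M β U)))) atTop
        (𝓝 ((Real.exp (-(β * U / 4 * (L : ℝ) ^ 2)) : ℂ) *
          (Matrix.gibbsWeight (β - s) (hubbardTorusWith 2 L 1 U (μ + U / 2)) * creation (orb (FermionTorus.ofTorusSite x) 0) *
            (Matrix.gibbsWeight s (hubbardTorusWith 2 L 1 U (μ + U / 2)) * annihilation (orb (FermionTorus.ofTorusSite y) 0))).trace /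
          Matrix.partitionFn β (hubbardTorusWith 2 L 1 0 μ))))
    (n : ℤ) (p : TorusSite 2 L) (ε : ℝ) (hε : 0 < ε) :
    ∃ M₁ : ℕ, ∀ M : ℕ, M₁ ≤ M → ∀ ω : MatsubaraIdx M, matsubaraInt M ω = n →
      ‖klSelfEnergy L M β U μ 0 klE0 (nScales β + 1) (ω, p) 0 -
          (1 / (-Complex.I * ((Real.pi * (2 * (n : ℝ) + 1) / β : ℝ) : ℂ) + (nambuXiCT L μ 0 p : ℂ)) -
              ∫ τ in (0 : ℝ)..β, cexp (I * ((Real.pi * (2 * (n : ℝ) + 1) / β : ℝ) : ℂ) * τ) *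
                Matrix.gibbsState β (hubbardTorusWith 2 L 1 U (μ + U / 2))
                  (Matrix.imagTimeEvolve (hubbardTorusWith 2 L 1 U (μ + U / 2)) (τ : ℂ) (momentumAnnihilation (-p) 0) *
                    momentumCreation (-p) 0)) *
            (-Complex.I * ((Real.pi * (2 * (n : ℝ) + 1) / β : ℝ) : ℂ) + (nambuXiCT L μ 0 p : ℂ)) ^ 2‖ ≤ ε := by
  -- pointwise limits + eventual sup bound of the `1+1` word (k3c5-p3 / k3c4-p2), hence `L¹(ds)` convergence to `Pinf = lim_M`
  obtain ⟨C₂, hpt, hbd⟩ := twoPoint_pointwise_and_bound (L := L) hβ U μ 0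
  have hz : ∀ x : TorusSite 2 L,
      IntervalIntegrable (fun s : ℝ => limUnder atTop (fun M : ℕ => gaussExpect ℂ (hubbardCovariance L M β μ 0)
        (positionField L M β 0 0 x s * positionField L M β 1 0 0 0 * grassmannExp (-(hubbardInteraction L M β U))))) volume 0 β ∧
      Tendsto (fun M : ℕ => ∫ s in (0 : ℝ)..β, ‖gaussExpect ℂ (hubbardCovariance L M β μ 0)
          (positionField L M β 0 0 x s * positionField L M β 1 0 0 0 * grassmannExp (-(hubbardInteraction L M β U))) -
        limUnder atTop (fun M : ℕ => gaussExpect ℂ (hubbardCovariance L M β μ 0)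
          (positionField L M β 0 0 x s * positionField L M β 1 0 0 0 * grassmannExp (-(hubbardInteraction L M β U))))‖)
        atTop (𝓝 0) := fun x =>
    l1_tendsto_of_pointwise_dominated hβ
      (fun M s => gaussExpect ℂ (hubbardCovariance L M β μ 0)
        (positionField L M β 0 0 x s * positionField L M β 1 0 0 0 * grassmannExp (-(hubbardInteraction L M β U))))
      (fun s => limUnder atTop (fun M : ℕ => gaussExpect ℂ (hubbardCovariance L M β μ 0)
        (positionField L M β 0 0 x s * positionField L M β 1 0 0 0 * grassmannExp (-(hubbardInteraction L M β U)))))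
      (fun M => continuous_twoPointWord (L := L) (M := M) β U μ 0 x 0) (hpt x) (hbd.mono fun M hM => hM x)
  obtain ⟨M₁, hM₁⟩ := klSelfEnergy_bare_label_limit (L := L) hβ U μ 0
    (fun x s => limUnder atTop (fun M : ℕ => gaussExpect ℂ (hubbardCovariance L M β μ 0)
      (positionField L M β 0 0 x s * positionField L M β 1 0 0 0 * grassmannExp (-(hubbardInteraction L M β U)))))
    (fun x => (hz x).1) _ (partitionLimit_ne_zero β U μ) (tendsto_effPartitionFn_hubbard_eq_partitionFn_div_allU hL hβ μ U)
    (fun x => (hz x).2) n p ε hε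
  refine ⟨M₁, fun M hM ω hω => ?_⟩
  have h := hM₁ M hM ω hω
  rw [twoPointTransform_limUnder_div_eq_neg_matsubaraGreen hβ U μ hH1 n p] at h
  -- the amputation algebra `(−𝒢 + ĝ)/ĝ² = (1/D − 𝒢)·D²`
  set Dp : ℂ := -Complex.I * ((Real.pi * (2 * (n : ℝ) + 1) / β : ℝ) : ℂ) + (nambuXiCT L μ 0 p : ℂ) with hDp
  have hDpne : Dp ≠ 0 := by
    intro h0
    have him := congrArg Complex.im h0
    simp [hDp] at him
    rcases him with h1 | h1
    · have h2 : ((2 * n + 1 : ℤ) : ℝ) ≠ 0 := by exact_mod_cast (show (2 * n + 1 : ℤ) ≠ 0 by omega)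
      push_cast at h2
      exact h2 h1
    · exact hβ.ne' h1
  set G : ℂ := ∫ τ in (0 : ℝ)..β, cexp (I * ((Real.pi * (2 * (n : ℝ) + 1) / β : ℝ) : ℂ) * τ) *
    Matrix.gibbsState β (hubbardTorusWith 2 L 1 U (μ + U / 2))
      (Matrix.imagTimeEvolve (hubbardTorusWith 2 L 1 U (μ + U / 2)) (τ : ℂ) (momentumAnnihilation (-p) 0) * momentumCreation (-p) 0)
    with hG
  have halg : (-G + 1 / Dp) / (1 / Dp) ^ 2 = (1 / Dp - G) * Dp ^ 2 := by
    field_simp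
    ring
  rwa [halg] at h

end Summit.HubbardSuperconductivity.HubbardSuperconductivity.Theorems.TwoPointAssembly

end
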